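import Summits.QuantumFields.BalabanUV.T4Continuum.Support.GradedWellSubContours

/-!
# T⁴ programme, spine node NE2 (U1a), sub-row Δ1 — THE GRADED WELL, supplier brick «GW-V» file B3: WHICH ROWS THE SUB-CONTOURS ARE
# (the charged set `Tset`, the ambient rows `omega1` / `omega2` of the two families, fibre cardinalities, and THE INTERIOR ANALYSIS: a level-1 sub-contour is either a typed row or interior to one unit block of the finer layer, where all its level-2 sub-contours are typed rows)

NE2 leaf prover 07, GEN 11 (`b2b-balaban-t4-ne2-formalise-leaf-07-g11`, numerics desk of sub-row Δ1), supplier brick «GW-V» for the row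
owner's GRADED WELL (R47 journal 2026-08-21 l.25022; objects `GradedSubBlocks` p244783 / `GradedWellData` p244847; offer l.25494; numerics:
memo `t4/T4-EST-NE2-D1-COLLAR.md` v1.1 §9.1b, job j114873 — `V = Q_GWᴴQ_GW − a·n^d·Q_⊤ᴴQ_⊤ ⪰ 0` to rounding for the typed `RowV`, FALSE for
the anchor-rule rows).

 * §6 `div_le_one_of_lt`, `arith_alpha`, `arith_gamma`; §7 `Tset`, `omega1`, `omega2`, `Xfull_omega1`, `Xfull_omega2`, **`card_fibre_omega1`**
   (`≤ r₁`), **`card_fibre_omega2`** (`≤ r₁·r′`); §8 **`omega1_mem_Tset`**, **`omega2_mem_Tset`** (cases (α) both level-1 blocks `= B` /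
   (β) crossing `B → B + e_μ` = a typed row / (γ) both `= B + e_μ`).

HONEST FRAMING (T4-DAG p. 1).  [folklore] finite-torus combinatorics, Cauchy–Schwarz and bookkeeping on OUR model objects (U = 1, a
layer map on unit blocks, `m` fixed, finite torus); no estimate of Bałaban's is asserted, certified or disputed; NE2 (U1a) NOT proved; spine
PROVED 0/9 unchanged; NOT [B9] (3.16)/(3.23)–(3.27)/(3.42) as printed; NOT infinite volume / mass gap / Clay.  HONEST DEPENDENCY: continuum
YM on T⁴ ⇐ BetaPertH ∧ nine spine estimates (0/9 proved); BetaPertH ⇐ (D1) ∧ (D4) ∧ CAP+tail; G-an2-4 gates asym, D1 and NE2/3/4.  No `sorry`.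
-/

noncomputable section

open scoped BigOperators ComplexConjugate Matrix
open Finset

namespace Summit.QuantumFields.BalabanUV.T4Continuum.GradedWellUnitMass

open Literature.MathematicalPhysics.QuantumFieldTheory.Balaban1983to89.B5Prop11Plancherel (Tor fine unitVec)
open Literature.MathematicalPhysics.QuantumFieldTheory.Balaban1983to89.B5Prop11Lower (nsq nsq_nonneg)
open Literature.MathematicalPhysics.QuantumFieldTheory.Balaban1983to89.B5Block118 (tstep tstep_zero tstep_succ)
open Literature.MathematicalPhysics.QuantumFieldTheory.Balaban1983to89.B5Blocks16 (blockOf)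
open Literature.MathematicalPhysics.QuantumFieldTheory.Balaban1983to89.B5G183RateUnitTower (lev lev_neZero)
open Summit.QuantumFields.BalabanUV.T4Continuum
open Summit.QuantumFields.BalabanUV.T4Continuum.GradedSubBlocks (Anchor Anc InSub site meanS avgS avgS_mulVec s_pos site_add
  val_site anchor_add_tstep shiftAnc)
open Literature.MathematicalPhysics.QuantumFieldTheory.Balaban1983to89.B5Composition116 (tstep_add)
open Summit.QuantumFields.BalabanUV.T4Continuum.GradedContourRefine (subAnc subAnc_val mulOff mulOff_val norm_sq_avgS_le
  anchor_of_dvd mul_lt_of_lt_div)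
open Summit.QuantumFields.BalabanUV.T4Continuum.GradedWellData (sGW sGW_dvd wGW wGW_sq wGW_nonneg TorK RowV QvGW lev_eq_pow)
open Summit.QuantumFields.BalabanUV.T4Continuum.GradedWellSlice (sGW_dvd_lev sGW_dvd_sGW)

variable {d : ℕ}

/-! ## §6 Arithmetic of the longitudinal offsets -/

/-- quotients of small offsets: `a, b < r → (a + b)/r ≤ 1`. [folklore] -/
theorem div_le_one_of_lt {a b r : ℕ} (ha : a < r) (hb : b < r) : (a + b) / r ≤ 1 := by
  have hr : 0 < r := lt_of_le_of_lt (Nat.zero_le _) ha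
  have : a + b < 2 * r := by omega
  have h2 : (a + b) / r < 2 := Nat.div_lt_of_lt_mul (by simpa [mul_comm] using this)
  omega

/-- interior case (α): the level-2 longitudinal offsets stay in the first unit block. [folklore] -/
theorem arith_alpha {s₁ s₂ r₁ r' n a b a' c : ℕ} (hn : s₁ * r₁ = n) (hs : s₂ * r' = s₁) (hs2 : 0 < s₂)
    (ha' : a' < r') (hc' : c < r') (hab : a + b + 1 < r₁) :
    s₁ * (a + b) + s₂ * (a' + c + 1) < n := by
  have h1 : a' + c + 1 ≤ 2 * r' - 1 := by omega
  have h2 : s₂ * (a' + c + 1) ≤ s₂ * (2 * r' - 1) := Nat.mul_le_mul_left _ h1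
  have h3 : s₂ * (2 * r' - 1) < 2 * s₁ := by
    have hr' : 1 ≤ r' := by omega
    calc s₂ * (2 * r' - 1) < s₂ * (2 * r') := Nat.mul_lt_mul_of_pos_left (by omega) hs2
      _ = 2 * s₁ := by rw [← hs]; ring
  have h4 : s₁ * (a + b + 2) ≤ n := by
    rw [← hn]; exact Nat.mul_le_mul_left _ (by omega)
  calc s₁ * (a + b) + s₂ * (a' + c + 1) < s₁ * (a + b) + 2 * s₁ := by omega
    _ = s₁ * (a + b + 2) := by ring
    _ ≤ n := h4

/-- interior case (γ): the level-2 longitudinal offsets lie in the second unit block. [folklore] -/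
theorem arith_gamma {s₁ s₂ r₁ r' n a b a' c : ℕ} (hn : s₁ * r₁ = n) (hs : s₂ * r' = s₁) (hs2 : 0 < s₂)
    (ha : a < r₁) (hb : b < r₁) (ha' : a' < r') (hc' : c < r') (hab : r₁ ≤ a + b) :
    n ≤ s₁ * (a + b) + s₂ * (a' + c) ∧ s₁ * (a + b) + s₂ * (a' + c + 1) < 2 * n := by
  constructor
  · calc n = s₁ * r₁ := hn.symm
      _ ≤ s₁ * (a + b) := Nat.mul_le_mul_left _ hab
      _ ≤ s₁ * (a + b) + s₂ * (a' + c) := Nat.le_add_right _ _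
  · have h1 : a + b ≤ 2 * r₁ - 2 := by omega
    have h2 : s₁ * (a + b) ≤ s₁ * (2 * r₁ - 2) := Nat.mul_le_mul_left _ h1
    have h3 : a' + c + 1 ≤ 2 * r' - 1 := by omega
    have h4 : s₂ * (a' + c + 1) ≤ s₂ * (2 * r' - 1) := Nat.mul_le_mul_left _ h3
    have hr1 : 1 ≤ r₁ := by omega
    have hr' : 1 ≤ r' := by omega
    have e1 : s₁ * (2 * r₁ - 2) = 2 * n - 2 * s₁ := by
      rw [← hn, Nat.mul_sub, Nat.mul_comm s₁ (2 * r₁), mul_assoc, Nat.mul_comm r₁ s₁, Nat.mul_comm s₁ 2]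
    have e2 : s₂ * (2 * r' - 1) = 2 * s₁ - s₂ := by
      rw [Nat.mul_sub, mul_one, ← hs]; ring_nf
    have hs1n : s₁ ≤ n := by rw [← hn]; exact Nat.le_mul_of_pos_right _ hr1
    have hs21 : s₂ ≤ s₁ := by rw [← hs]; exact Nat.le_mul_of_pos_right _ hr'
    omega

/-! ## §7 The per-unit-row bound -/

section Row

variable (L : ℕ) [NeZero L] (M : Fin d → ℕ) [hM : ∀ μ, NeZero (M μ)] (k m : ℕ) (layer : Tor M → ℕ)

/-- the rows CHARGED by the unit contour `(z, μ)`: typed rows of layer `≥ 1`, direction `μ`, anchor in the block of `z` or the next one. [folklore] -/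
def Tset (z : Anc (fine (lev L k) M) (lev L k)) (μ : Fin d) : Finset (Amb L M k m) :=
  (rowSet L M k m layer).filter fun ω =>
    ω.2.2 = μ ∧ 1 ≤ (ω.1 : ℕ) ∧
      (blockOf (lev L k) M ω.2.1.1 = blockOf (lev L k) M z.1 ∨
        blockOf (lev L k) M ω.2.1.1 = blockOf (lev L k) M z.1 + tstep M μ 1)

/-- the level-1 ambient rows of the unit contour `(z, μ)` at layer index `lo`. [folklore] -/
def omega1 (lo : ℕ) (hlo : lo < m + 1) (z : Anc (fine (lev L k) M) (lev L k)) (μ : Fin d)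
    (x : (Fin d → Fin (lev L k / sGW L k lo)) × Fin (lev L k / sGW L k lo)) : Amb L M k m :=
  ⟨⟨lo, hlo⟩, (subOne L M k lo z μ x.1 x.2, μ)⟩

/-- the level-2 ambient rows at layer index `hi`. [folklore] -/
def omega2 (lo hi : ℕ) (hlh : lo ≤ hi) (hhi : hi < m + 1) (z : Anc (fine (lev L k) M) (lev L k)) (μ : Fin d)
    (xy : ((Fin d → Fin (lev L k / sGW L k lo)) × Fin (lev L k / sGW L k lo))
      × ((Fin d → Fin (sGW L k lo / sGW L k hi)) × Fin (sGW L k lo / sGW L k hi))) : Amb L M k m :=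
  ⟨⟨hi, hhi⟩, (subTwo L M k hlh z μ xy.1.1 xy.1.2 xy.2.1 xy.2.2, μ)⟩

/-- `Xfull` of a level-1 row is `w_lo²·|a₁|²`. [folklore] -/
theorem Xfull_omega1 (A : TorK L M k × Fin d → ℂ) (lo : ℕ) (hlo : lo < m + 1) (z : Anc (fine (lev L k) M) (lev L k))
    (μ : Fin d) (x : (Fin d → Fin (lev L k / sGW L k lo)) × Fin (lev L k / sGW L k lo)) :
    Xfull L M k m A (omega1 L M k m lo hlo z μ x)
      = wGW L k d lo ^ 2 * ‖(avgS (fine (lev L k) M) (sGW L k lo) *ᵥ A) (subOne L M k lo z μ x.1 x.2, μ)‖ ^ 2 := rfl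

/-- `Xfull` of a level-2 row is `w_hi²·|a₂|²`. [folklore] -/
theorem Xfull_omega2 (A : TorK L M k × Fin d → ℂ) (lo hi : ℕ) (hlh : lo ≤ hi) (hhi : hi < m + 1)
    (z : Anc (fine (lev L k) M) (lev L k)) (μ : Fin d)
    (xy : ((Fin d → Fin (lev L k / sGW L k lo)) × Fin (lev L k / sGW L k lo))
      × ((Fin d → Fin (sGW L k lo / sGW L k hi)) × Fin (sGW L k lo / sGW L k hi))) :
    Xfull L M k m A (omega2 L M k m lo hi hlh hhi z μ xy)
      = wGW L k d hi ^ 2 * ‖(avgS (fine (lev L k) M) (sGW L k hi) *ᵥ A) (subTwo L M k hlh z μ xy.1.1 xy.1.2 xy.2.1 xy.2.2, μ)‖ ^ 2 :=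
  rfl

/-- fibres of `omega1` over a fixed row have at most `r₁` elements (injectivity in `o` at fixed `q`). [folklore] -/
theorem card_fibre_omega1 (lo : ℕ) (hlo : lo < m + 1) (z : Anc (fine (lev L k) M) (lev L k)) (μ : Fin d)
    (S : Finset ((Fin d → Fin (lev L k / sGW L k lo)) × Fin (lev L k / sGW L k lo))) (ω : Amb L M k m) :
    (S.filter (fun x => omega1 L M k m lo hlo z μ x = ω)).card ≤ lev L k / sGW L k lo := by
  classical
  have h := Finset.card_le_card_of_injOn (s := S.filter (fun x => omega1 L M k m lo hlo z μ x = ω))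
    (t := (Finset.univ : Finset (Fin (lev L k / sGW L k lo)))) Prod.snd (fun x _ => Finset.mem_univ _) ?_
  · simpa using h
  · intro x hx y hy hxy
    have ex := (Finset.mem_filter.mp (Finset.mem_coe.mp hx)).2
    have ey := (Finset.mem_filter.mp (Finset.mem_coe.mp hy)).2
    have e : omega1 L M k m lo hlo z μ x = omega1 L M k m lo hlo z μ y := ex.trans ey.symm
    have e2 : subOne L M k lo z μ x.1 x.2 = subOne L M k lo z μ y.1 y.2 := by
      have := (Sigma.mk.inj_iff.mp e).2
      exact (Prod.mk.inj (eq_of_heq this)).1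
    have hq : x.2 = y.2 := hxy
    rw [hq] at e2
    exact Prod.ext (subOne_inj L M k lo z μ y.2 e2) hq

/-- fibres of `omega2` have at most `r₁·r′` elements (injectivity in `(o, o′)` at fixed `(q, q′)`). [folklore] -/
theorem card_fibre_omega2 (lo hi : ℕ) (hlh : lo ≤ hi) (hhi : hi < m + 1) (z : Anc (fine (lev L k) M) (lev L k)) (μ : Fin d)
    (S : Finset (((Fin d → Fin (lev L k / sGW L k lo)) × Fin (lev L k / sGW L k lo))
      × ((Fin d → Fin (sGW L k lo / sGW L k hi)) × Fin (sGW L k lo / sGW L k hi)))) (ω : Amb L M k m) :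
    (S.filter (fun xy => omega2 L M k m lo hi hlh hhi z μ xy = ω)).card
      ≤ (lev L k / sGW L k lo) * (sGW L k lo / sGW L k hi) := by
  classical
  have h := Finset.card_le_card_of_injOn (s := S.filter (fun xy => omega2 L M k m lo hi hlh hhi z μ xy = ω))
    (t := (Finset.univ : Finset (Fin (lev L k / sGW L k lo) × Fin (sGW L k lo / sGW L k hi))))
    (fun xy => (xy.1.2, xy.2.2)) (fun x _ => Finset.mem_univ _) ?_
  · simpa using h
  · intro x hx y hy hxy
    have ex := (Finset.mem_filter.mp (Finset.mem_coe.mp hx)).2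
    have ey := (Finset.mem_filter.mp (Finset.mem_coe.mp hy)).2
    have e : omega2 L M k m lo hi hlh hhi z μ x = omega2 L M k m lo hi hlh hhi z μ y := ex.trans ey.symm
    have e2 : subTwo L M k hlh z μ x.1.1 x.1.2 x.2.1 x.2.2 = subTwo L M k hlh z μ y.1.1 y.1.2 y.2.1 y.2.2 := by
      have := (Sigma.mk.inj_iff.mp e).2
      exact (Prod.mk.inj (eq_of_heq this)).1
    have hq : x.1.2 = y.1.2 := (Prod.mk.inj hxy).1
    have hq' : x.2.2 = y.2.2 := (Prod.mk.inj hxy).2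
    rw [hq, hq'] at e2
    have e3 := subTwo_inj L M k hlh z μ y.1.2 y.2.2 (a₁ := (x.1.1, x.2.1)) (a₂ := (y.1.1, y.2.1)) e2
    have e4 : x.1.1 = y.1.1 := (Prod.mk.inj e3).1
    have e5 : x.2.1 = y.2.1 := (Prod.mk.inj e3).2
    exact Prod.ext (Prod.ext e4 hq) (Prod.ext e5 hq')

end Row

end Summit.QuantumFields.BalabanUV.T4Continuum.GradedWellUnitMass

namespace Summit.QuantumFields.BalabanUV.T4Continuum.GradedWellUnitMass

open Literature.MathematicalPhysics.QuantumFieldTheory.Balaban1983to89.B5Prop11Plancherel (Tor fine unitVec)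
open Literature.MathematicalPhysics.QuantumFieldTheory.Balaban1983to89.B5Prop11Lower (nsq nsq_nonneg)
open Literature.MathematicalPhysics.QuantumFieldTheory.Balaban1983to89.B5Block118 (tstep tstep_zero tstep_succ)
open Literature.MathematicalPhysics.QuantumFieldTheory.Balaban1983to89.B5Blocks16 (blockOf)
open Literature.MathematicalPhysics.QuantumFieldTheory.Balaban1983to89.B5G183RateUnitTower (lev lev_neZero)
open Summit.QuantumFields.BalabanUV.T4Continuum
open Summit.QuantumFields.BalabanUV.T4Continuum.ScalarPlantingDefect (val_blockOf)
open Summit.QuantumFields.BalabanUV.T4Continuum.GradedSubBlocks (Anchor Anc InSub site meanS avgS avgS_mulVec s_pos site_add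
  val_site anchor_add_tstep shiftAnc)
open Literature.MathematicalPhysics.QuantumFieldTheory.Balaban1983to89.B5Composition116 (tstep_add)
open Summit.QuantumFields.BalabanUV.T4Continuum.GradedContourRefine (subAnc subAnc_val mulOff mulOff_val norm_sq_avgS_le
  anchor_of_dvd mul_lt_of_lt_div)
open Summit.QuantumFields.BalabanUV.T4Continuum.GradedWellData (sGW sGW_dvd wGW wGW_sq wGW_nonneg TorK RowV QvGW lev_eq_pow)
open Summit.QuantumFields.BalabanUV.T4Continuum.GradedWellSlice (sGW_dvd_lev sGW_dvd_sGW)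

variable {d : ℕ}

section RowBound

variable (L : ℕ) [NeZero L] (M : Fin d → ℕ) [hM : ∀ μ, NeZero (M μ)] (k m : ℕ) (layer : Tor M → ℕ)

/-! ## §8 Which rows the sub-contours are -/

/-- a level-1 sub-contour that IS a typed row is charged to `Tset`. [folklore] -/
theorem omega1_mem_Tset (lo : ℕ) (hlo : lo < m + 1) (hlo1 : 1 ≤ lo) (z : Anc (fine (lev L k) M) (lev L k)) (μ : Fin d)
    (x : (Fin d → Fin (lev L k / sGW L k lo)) × Fin (lev L k / sGW L k lo))
    (hrow : omega1 L M k m lo hlo z μ x ∈ rowSet L M k m layer) :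
    omega1 L M k m lo hlo z μ x ∈ Tset L M k m layer z μ := by
  rw [Tset, Finset.mem_filter]
  refine ⟨hrow, rfl, hlo1, ?_⟩
  show blockOf (lev L k) M (subOne L M k lo z μ x.1 x.2).1 = _ ∨ blockOf (lev L k) M (subOne L M k lo z μ x.1 x.2).1 = _
  rw [blockOf_subOne]
  rcases Nat.le_one_iff_eq_zero_or_eq_one.mp (div_le_one_of_lt (x.1 μ).isLt x.2.isLt) with h | h
  · left; rw [h, tstep_zero, add_zero]
  · right; rw [h]

/-- **THE INTERIOR ANALYSIS**: a level-1 sub-contour that is NOT a typed row lies inside one unit block `F` of layer `hi`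
(both endpoint blocks `= F`), and then every level-2 sub-contour of it is a typed row of layer `hi` inside `F`. [folklore] -/
theorem omega2_mem_Tset (lo hi : ℕ) (hlh : lo ≤ hi) (hhi : hi < m + 1) (hhi1 : 1 ≤ hi)
    (z : Anc (fine (lev L k) M) (lev L k)) (μ : Fin d)
    (hB : (layer (blockOf (lev L k) M z.1) = lo ∧ layer (blockOf (lev L k) M z.1 + tstep M μ 1) = hi) ∨
          (layer (blockOf (lev L k) M z.1) = hi ∧ layer (blockOf (lev L k) M z.1 + tstep M μ 1) = lo))
    (x : (Fin d → Fin (lev L k / sGW L k lo)) × Fin (lev L k / sGW L k lo))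
    (hx : omega1 L M k m lo (lt_of_le_of_lt hlh hhi) z μ x ∉ rowSet L M k m layer)
    (y : (Fin d → Fin (sGW L k lo / sGW L k hi)) × Fin (sGW L k lo / sGW L k hi)) :
    omega2 L M k m lo hi hlh hhi z μ (x, y) ∈ Tset L M k m layer z μ := by
  -- names and arithmetic facts
  have hn : sGW L k lo * (lev L k / sGW L k lo) = lev L k := Nat.mul_div_cancel' (sGW_dvd_lev L k lo)
  have hs : sGW L k hi * (sGW L k lo / sGW L k hi) = sGW L k lo := Nat.mul_div_cancel' (sGW_dvd_sGW L k hlh)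
  have hs2 : 0 < sGW L k hi := sGW_pos L k hi
  have ha := (x.1 μ).isLt
  have hb := x.2.isLt
  have ha' := (y.1 μ).isLt
  have hc' := y.2.isLt
  have hnpos : 0 < lev L k := lev_pos L k
  -- what `hx` says about the level-1 blocks
  rw [mem_rowSet] at hx
  change ¬ min (layer (blockOf (lev L k) M (subOne L M k lo z μ x.1 x.2).1))
      (layer (blockOf (lev L k) M ((subOne L M k lo z μ x.1 x.2).1 + tstep (fine (lev L k) M) μ (sGW L k lo)))) = lo at hx
  rw [blockOf_subOne, blockOf_subOne_shift] at hx
  -- the goal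
  rw [Tset, Finset.mem_filter, mem_rowSet]
  change (min (layer (blockOf (lev L k) M (subTwo L M k hlh z μ x.1 x.2 y.1 y.2).1))
      (layer (blockOf (lev L k) M ((subTwo L M k hlh z μ x.1 x.2 y.1 y.2).1 + tstep (fine (lev L k) M) μ (sGW L k hi)))) = hi)
    ∧ μ = μ ∧ 1 ≤ hi ∧ (blockOf (lev L k) M (subTwo L M k hlh z μ x.1 x.2 y.1 y.2).1 = blockOf (lev L k) M z.1 ∨
      blockOf (lev L k) M (subTwo L M k hlh z μ x.1 x.2 y.1 y.2).1 = blockOf (lev L k) M z.1 + tstep M μ 1)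
  rw [blockOf_subTwo, blockOf_subTwo_shift]
  rcases Nat.lt_trichotomy ((x.1 μ : ℕ) + x.2 + 1) (lev L k / sGW L k lo) with hlt | heq | hgt
  · -- (α) both level-1 blocks are B: layer B ≠ lo, so layer B = hi; level 2 stays in B
    have e1 : ((x.1 μ : ℕ) + x.2) / (lev L k / sGW L k lo) = 0 := Nat.div_eq_of_lt (by omega)
    have e2 : ((x.1 μ : ℕ) + x.2 + 1) / (lev L k / sGW L k lo) = 0 := Nat.div_eq_of_lt hlt
    rw [e1, e2, tstep_zero, add_zero, min_self] at hx
    have hlB : layer (blockOf (lev L k) M z.1) = hi := by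
      rcases hB with ⟨h1, _⟩ | ⟨h1, _⟩
      · exact absurd h1 hx
      · exact h1
    have hV' : sGW L k lo * ((x.1 μ : ℕ) + x.2) + sGW L k hi * ((y.1 μ : ℕ) + y.2 + 1) < lev L k :=
      arith_alpha hn hs hs2 ha' hc' hlt
    have hV : sGW L k lo * ((x.1 μ : ℕ) + x.2) + sGW L k hi * ((y.1 μ : ℕ) + y.2) < lev L k :=
      lt_of_le_of_lt (Nat.add_le_add_left (Nat.mul_le_mul_left _ (Nat.le_succ _)) _) hV'
    rw [Nat.div_eq_of_lt hV, Nat.div_eq_of_lt hV', tstep_zero, add_zero, min_self]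
    exact ⟨hlB, rfl, hhi1, Or.inl rfl⟩
  · -- (β) the level-1 contour crosses from B to B + e_μ: it IS a row (min = lo) — contradiction
    exfalso
    have e1 : ((x.1 μ : ℕ) + x.2) / (lev L k / sGW L k lo) = 0 := Nat.div_eq_of_lt (by omega)
    have e2 : ((x.1 μ : ℕ) + x.2 + 1) / (lev L k / sGW L k lo) = 1 := by rw [heq]; exact Nat.div_self (by omega)
    rw [e1, e2, tstep_zero, add_zero] at hx
    apply hx
    rcases hB with ⟨h1, h2⟩ | ⟨h1, h2⟩
    · rw [h1, h2]; exact min_eq_left hlh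
    · rw [h1, h2]; exact min_eq_right hlh
  · -- (γ) both level-1 blocks are B + e_μ: layer (B + e_μ) = hi; level 2 stays in B + e_μ
    have hge : lev L k / sGW L k lo ≤ (x.1 μ : ℕ) + x.2 := by omega
    have e1 : ((x.1 μ : ℕ) + x.2) / (lev L k / sGW L k lo) = 1 :=
      Nat.div_eq_of_lt_le (by omega) (by omega)
    have e2 : ((x.1 μ : ℕ) + x.2 + 1) / (lev L k / sGW L k lo) = 1 :=
      Nat.div_eq_of_lt_le (by omega) (by omega)
    rw [e1, e2, min_self] at hx
    have hlB : layer (blockOf (lev L k) M z.1 + tstep M μ 1) = hi := by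
      rcases hB with ⟨_, h2⟩ | ⟨_, h2⟩
      · exact h2
      · exact absurd h2 hx
    obtain ⟨hVlo, hV'hi⟩ := arith_gamma hn hs hs2 ha hb ha' hc' hge
    have hVhi : sGW L k lo * ((x.1 μ : ℕ) + x.2) + sGW L k hi * ((y.1 μ : ℕ) + y.2) < 2 * lev L k :=
      lt_of_le_of_lt (Nat.add_le_add_left (Nat.mul_le_mul_left _ (Nat.le_succ _)) _) hV'hi
    have hV'lo : lev L k ≤ sGW L k lo * ((x.1 μ : ℕ) + x.2) + sGW L k hi * ((y.1 μ : ℕ) + y.2 + 1) :=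
      le_trans hVlo (Nat.add_le_add_left (Nat.mul_le_mul_left _ (Nat.le_succ _)) _)
    have d1 : (sGW L k lo * ((x.1 μ : ℕ) + x.2) + sGW L k hi * ((y.1 μ : ℕ) + y.2)) / lev L k = 1 :=
      Nat.div_eq_of_lt_le (by omega) (by omega)
    have d2 : (sGW L k lo * ((x.1 μ : ℕ) + x.2) + sGW L k hi * ((y.1 μ : ℕ) + y.2 + 1)) / lev L k = 1 :=
      Nat.div_eq_of_lt_le (by omega) (by omega)
    rw [d1, d2, min_self]
    exact ⟨hlB, rfl, hhi1, Or.inr rfl⟩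

end RowBound

end Summit.QuantumFields.BalabanUV.T4Continuum.GradedWellUnitMass

end
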